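import Mathlib
import HarnessLib
import Summits.HubbardSuperconductivity.HubbardSuperconductivity.Theorems.KLProgrammeKLRegimeCountertermMuFlowExt
import Summits.HubbardSuperconductivity.HubbardSuperconductivity.Theorems.KLProgrammeKLRegimeSplitSymInterp

/-!
# Route `KLProgramme`, crux K3 (stmt-HubbardSuperconductivity-19937) — the FLAT CUTOFF on / off the tube and the GRID READING of a
# G-extended angular function at a flat-tube lattice momentum

Cell gate-hubbard-kl, seat p1b (g4).  Two small links of the child-2 closing route under the Δ18 repair (child `KLRegimeCountertermV9/V10`,
stmt-…-19664; steps (1)–(2) of p1b's STATUS 2026-08-26 l.994): `klFlatCutoff L μ k = 1 − χ₂(ξ_μ(k)²/(4·klFlatR²))` (`…SplitBundleV6`) is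
`= 1` for `|ξ_μ(k)| ≤ klFlatR` and `= 0` for `|ξ_μ(k)| ≥ 2·klFlatR` (Salmhofer's `χ₂ = 0` on `[0, ¼]`, `= 1` on `[1, ∞)`); hence the
lattice data of `klFrameExtG L μ f` equal `f(momentumAngle L k)` on flat-tube sites and the angular MEAN on far sites, and — by the
interpolation theorem `symInterp_eval_latticeMomentum` (`…SplitSymInterp`) — for `D₄`-symmetric data the G-extension READS `f` at every
flat-tube lattice momentum: `(klFrameExtG L μ f).eval (latticeMomentum L k) = f (momentumAngle L k)` (`eval_klFrameExtG_latticeMomentum_of_flat`;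
the `D₄`-symmetry of the data `k ↦ mean f + χ_flat(k)(f(θ(k)) − mean f)` is taken as hypotheses — its derivation from the angular
symmetries of `f` and the lattice covariance of `momentumAngle` is the consumer's / k3c3-p3's announced (b)).  Proofs only.
-/

noncomputable section

namespace Summit.HubbardSuperconductivity.HubbardSuperconductivity.Theorems.KLRegimeSplit

set_option linter.dupNamespace false -- summit = problem name (single-conjunct summit), D-0017

open Real Literature.MathematicalPhysics.QuantumLattice Literature.Probability.LatticeModels

variable (L : ℕ) [NeZero L]

/-! ## §1 The flat cutoff on and off the tube -/

/-- `klFlatR > 0`. -/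
theorem klFlatR_pos : 0 < klFlatR := by unfold klFlatR; norm_num

/-- **On the flat tube the cutoff is `1`**: `|ξ_μ(k)| ≤ klFlatR ⇒ klFlatCutoff L μ k = 1`. -/
theorem klFlatCutoff_eq_one_of_abs_le {μ : ℝ} {k : TorusSite 2 L} (h : |nambuXi L μ k| ≤ klFlatR) : klFlatCutoff L μ k = 1 := by
  unfold klFlatCutoff
  have hR := klFlatR_pos
  have hsq : nambuXi L μ k ^ 2 ≤ klFlatR ^ 2 := sq_le_sq' (abs_le.1 h).1 (abs_le.1 h).2
  have hx : nambuXi L μ k ^ 2 / (4 * klFlatR ^ 2) ≤ 1 / 4 := by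
    rw [div_le_iff₀ (by positivity)]
    linarith
  rw [salmhoferCutoff_of_le hx, sub_zero]

/-- **Off the doubled tube the cutoff is `0`**: `2·klFlatR ≤ |ξ_μ(k)| ⇒ klFlatCutoff L μ k = 0`. -/
theorem klFlatCutoff_eq_zero_of_le_abs {μ : ℝ} {k : TorusSite 2 L} (h : 2 * klFlatR ≤ |nambuXi L μ k|) : klFlatCutoff L μ k = 0 := by
  unfold klFlatCutoff
  have hR := klFlatR_pos
  have hsq : (2 * klFlatR) ^ 2 ≤ nambuXi L μ k ^ 2 := by
    have h0 : 0 ≤ 2 * klFlatR := by linarith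
    calc (2 * klFlatR) ^ 2 ≤ |nambuXi L μ k| ^ 2 := pow_le_pow_left₀ h0 h 2
      _ = nambuXi L μ k ^ 2 := sq_abs _
  have hx : 1 ≤ nambuXi L μ k ^ 2 / (4 * klFlatR ^ 2) := by
    rw [le_div_iff₀ (by positivity)]
    linarith
  rw [salmhoferCutoff_of_ge hx, sub_self]

/-- The flat cutoff takes values in `[0, 1]`. -/
theorem klFlatCutoff_mem_Icc (μ : ℝ) (k : TorusSite 2 L) : klFlatCutoff L μ k ∈ Set.Icc (0 : ℝ) 1 := by
  unfold klFlatCutoff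
  have h := salmhoferCutoff_mem_Icc (nambuXi L μ k ^ 2 / (4 * klFlatR ^ 2))
  constructor <;> linarith [h.1, h.2]

/-! ## §2 The lattice data of the G-extension -/

/-- On a flat-tube site the datum of `klFrameExtG L μ f` is `f(θ(k))`. -/
theorem klFrameExtG_datum_of_flat {μ : ℝ} (f : ℝ → ℝ) {k : TorusSite 2 L} (h : |nambuXi L μ k| ≤ klFlatR) :
    klAngularMean f + klFlatCutoff L μ k * (f (momentumAngle L k) - klAngularMean f) = f (momentumAngle L k) := by
  rw [klFlatCutoff_eq_one_of_abs_le L h]; ring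

/-- Off the doubled tube the datum of `klFrameExtG L μ f` is the angular mean. -/
theorem klFrameExtG_datum_of_far {μ : ℝ} (f : ℝ → ℝ) {k : TorusSite 2 L} (h : 2 * klFlatR ≤ |nambuXi L μ k|) :
    klAngularMean f + klFlatCutoff L μ k * (f (momentumAngle L k) - klAngularMean f) = klAngularMean f := by
  rw [klFlatCutoff_eq_zero_of_le_abs L h]; ring

/-- The datum differs from the mean by at most `|f(θ(k)) − mean f|` everywhere (`χ_flat ∈ [0,1]`). -/
theorem abs_klFrameExtG_datum_sub_mean_le (μ : ℝ) (f : ℝ → ℝ) (k : TorusSite 2 L) :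
    |klAngularMean f + klFlatCutoff L μ k * (f (momentumAngle L k) - klAngularMean f) - klAngularMean f| ≤
      |f (momentumAngle L k) - klAngularMean f| := by
  have h := klFlatCutoff_mem_Icc L μ k
  rw [add_sub_cancel_left, abs_mul, abs_of_nonneg h.1]
  exact mul_le_of_le_one_left (abs_nonneg _) h.2

/-! ## §3 The grid reading of a G-extension at a flat-tube lattice momentum -/

/-- **GRID READING.**  If the lattice data `g(k) = mean f + χ_flat(k)·(f(θ(k)) − mean f)` of `klFrameExtG L μ f` are `D₄`-symmetric
(even, reflection- and swap-invariant on the torus sites), then at every FLAT-TUBE lattice momentum the G-extension reads `f`: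
`(klFrameExtG L μ f).eval (latticeMomentum L k) = f (momentumAngle L k)`. -/
theorem eval_klFrameExtG_latticeMomentum_of_flat {μ : ℝ} (f : ℝ → ℝ)
    (heven : ∀ k : TorusSite 2 L,
      klAngularMean f + klFlatCutoff L μ (-k) * (f (momentumAngle L (-k)) - klAngularMean f) =
        klAngularMean f + klFlatCutoff L μ k * (f (momentumAngle L k) - klAngularMean f))
    (hrefl : ∀ k : TorusSite 2 L,
      klAngularMean f + klFlatCutoff L μ ![k 0, -k 1] * (f (momentumAngle L ![k 0, -k 1]) - klAngularMean f) =
        klAngularMean f + klFlatCutoff L μ k * (f (momentumAngle L k) - klAngularMean f))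
    (hswap : ∀ k : TorusSite 2 L,
      klAngularMean f + klFlatCutoff L μ ![k 1, k 0] * (f (momentumAngle L ![k 1, k 0]) - klAngularMean f) =
        klAngularMean f + klFlatCutoff L μ k * (f (momentumAngle L k) - klAngularMean f))
    {k : TorusSite 2 L} (hk : |nambuXi L μ k| ≤ klFlatR) :
    (klFrameExtG L μ f).eval (latticeMomentum L k) = f (momentumAngle L k) := by
  unfold klFrameExtG
  rw [symInterp_eval_latticeMomentum _ heven hrefl hswap k]
  exact klFrameExtG_datum_of_flat L f hk

/-- **GRID READING, general site**: under the same symmetry, at ANY lattice momentum the G-extension reads its own datum, which is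
within `|f(θ(k)) − mean f|` of the mean and equals `f(θ(k))` on the flat tube. -/
theorem eval_klFrameExtG_latticeMomentum {μ : ℝ} (f : ℝ → ℝ)
    (heven : ∀ k : TorusSite 2 L,
      klAngularMean f + klFlatCutoff L μ (-k) * (f (momentumAngle L (-k)) - klAngularMean f) =
        klAngularMean f + klFlatCutoff L μ k * (f (momentumAngle L k) - klAngularMean f))
    (hrefl : ∀ k : TorusSite 2 L,
      klAngularMean f + klFlatCutoff L μ ![k 0, -k 1] * (f (momentumAngle L ![k 0, -k 1]) - klAngularMean f) =
        klAngularMean f + klFlatCutoff L μ k * (f (momentumAngle L k) - klAngularMean f))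
    (hswap : ∀ k : TorusSite 2 L,
      klAngularMean f + klFlatCutoff L μ ![k 1, k 0] * (f (momentumAngle L ![k 1, k 0]) - klAngularMean f) =
        klAngularMean f + klFlatCutoff L μ k * (f (momentumAngle L k) - klAngularMean f))
    (k : TorusSite 2 L) :
    (klFrameExtG L μ f).eval (latticeMomentum L k) =
      klAngularMean f + klFlatCutoff L μ k * (f (momentumAngle L k) - klAngularMean f) := by
  unfold klFrameExtG
  exact symInterp_eval_latticeMomentum _ heven hrefl hswap k

end Summit.HubbardSuperconductivity.HubbardSuperconductivity.Theorems.KLRegimeSplit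

end
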